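import Mathlib
import Literature.MathematicalPhysics.QuantumFieldTheory.Balaban1983to89.B9Thm315Decay

/-! # `Balaban1983to89.B9Eq3169Mu` — the linear function μ(B) of (3.169): *"The δ-functions above determine μ uniquely
# as a linear function of B"* — existence, uniqueness, the printed formula, linearity, and the LOCALITY of the dressing
# `E = I + D̄μ(·)` of (3.185) (finite range, bounded row sums), which discharges the two locality clauses of
# `B9Thm315Decay.Rep3185` — kernel-checked, [folklore] algebra over the printed definitions

CITATION HEADER (lean-in-tree rule).  Paper sub-cell `b2b-balaban-b09` (gen 12, journal claim B9-EQ3169-MU, cell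
pub-balaban) on T. Bałaban, *Propagators for lattice gauge theories in a background field*, Commun. Math. Phys. **99**
(1985) 389–434 [`Balaban1985BackgroundPropagators`] (= B9; held `paper:balaban1985-cmp99-background-propagators`;
journal page = PDF page + 388), Sect. A p. 390 [PDF 2], p. 393 [PDF 5] and Sect. E pp. 427–432 [PDF 39–44] (renders
`b2b-balaban-ref1/pages/1985-cmp99-background-propagators/1985-cmp99-background-propagators-p002-x2.png`, `…-p005-x2.png`,
`…-p030-x2.png`, `…-p039-x2.png`, `…-p040-x2.png`, `…-p041-x2.png`, `…-p042-x2.png` READ AS IMAGES for this module, not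
from an OCR layer).  USED BY NAME, nothing restated: `B9Thm315Decay.Rep3185` / `bound_of_rep3185` (gen 11: the data of
(3.185) at one configuration, whose clauses *"E has range ≤ r"* and *"row ℓ¹-sums of E ≤ m"* were HYPOTHESES there —
*"The VALUES of r and m are NOT computed here"*), `B4Sect5Torus.IsPseudoDist` (+ `.comp`), r1's carriers `B9.Geometry`,
`B9.Backgrounds`, `B9.SiteKernel`.  RELATED, NOT REUSED (different level): `Setup.ContourData` / `Setup.AxialGauge`
(abstract group-valued `holTo`, no bond lists), `B11AxialTransport190.holo` / `transport_unique` / `transport_local`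
(GROUP-level axial transport along site paths), `T4AxialChain` (normed chain estimates) — the present module is the
LINEARISED (Lie-algebra level) calculus of transported sums along bond chains, which none of them provides.  No existing
module is modified.

WHAT IS PRINTED (verbatim).
* p. 390 [PDF 2]: *"Let us recall that R(U)X = UXU⁻¹."* … *"Let us introduce covariant derivatives. For a matrix valued
  function A defined at points of the lattice we put (D^η_{U₀}A)(b) = η⁻¹(R(U₀(b))A(b₊) − A(b₋)),"* (the print's symbol
  is A; below this site function is called μ or λ); p. 418 [PDF 30],
  (3.114)–(3.115): *"(QD^{L⁻¹}λ)(c) = R̄_c(Q′λ)(c₊) − (Q′λ)(c₋) = (D_ŪQ′λ)(c). (3.114) Iterating this identity we obtain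
  finally Q_jDλ = D^{L^jη}_{Ū^j}Q′_jλ = D̄^jQ′_jλ, (3.115) where the last equality is a definition of the symbol D̄^j."*
* p. 393 [PDF 5], the ONE-STEP line of the display group (3.18)–(3.19) — itself UNNUMBERED, standing between
  (3.18) *"(Q′λ)(y) = (Q′_j(U)λ)(y) for y∈Λ_j,"* and its j-step iterate (3.19) *"(Q′_j(U)λ)(y) = … =
  Σ_{x∈B^j(y)} L^{−jd}R(U(Γ^{(j)}_{y,x}))λ(x)"*; cited below as «p.393 (3.18)–(3.19)»: *"(Q′(V)λ)(y) =
  Σ_{x∈B(y)} L^{−d}R(V(Γ_{y,x}))λ(x),"* and *"The contours Γ^{(j)}_{y,x}, x∈B^j(y), and the contour variables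
  U(Γ^{(j)}_{y,x}) were defined by (52), (53) in [5]."*  ([5] = [`Balaban1985Averaging`], which B9's reference list
  p. 434 cites as *"Harvard preprint HUTMP B147, to be published in CMP"*: the numbers (52), (53) are the PREPRINT's —
  in the published text (CMP 98) (52) p. 26 is the small-field condition *"|U(∂p) − 1| < α₀η², η = L^{−k}"* and (53)
  p. 26 the inductive plaquette bound *"|Ū^j(∂p) − 1| < α₀L^{2j}η² + C₀(α₀L^{2j}η²)²·[1 + L^{−2}(1 + C₀α₀)² + …
  + L^{−2(j−1)}(1 + C₀α₀)^{2(j−1)}]. (53)"* (neither defines contours; v1.2), and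
  the block contours with initial point y are the UNNUMBERED display of p. 24: *"This means that we take the contours
  Γ_{y,x} = [y, (y₁, …, y_{d−1}, x_d)] ∪ … ∪ [(y₁, x₂, …, x_d), x]"* — the straight-line contours of
  [`Balaban1984PropagatorsI`] (1.7) p. 18, typed in the tree as `B6BondElimination.contour`.  The same paper, p. 27
  (58), writes the block axial gauge conditions bond by bond with transports to the initial point: *"(R_{0,y}V′)(Γ_{y,x})
  = Π_{b⊂Γ_{y,x}} R(V₀(Γ_{y,b₋}))V′_b = 1, x ∈ B(y), x ≠ y. (58)"* — the multiplicative form of the transported sums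
  (R_y(V)B)(Γ_{y,x}) of reading (b) below.)
* p. 427 [PDF 39]: *"We need operators with Dirichlet boundary conditions outside some domain Λ of the unit lattice. We
  assume that Λ ⊂ Λ_k = Ω_k^{(k)}, Λ is a union of big blocks, and a distance between Λ and Λ_kᶜ is bigger than RM."*;
  (3.155): *"e^{(1/2)⟨g,C^{(k)}(Λ)g⟩} = (Z^{(k)}(Λ))⁻¹∫dB↾_Λ δ(Q₁B)δ_{Ax}(B)·exp[…] (3.155) where … g is an arbitrary Lie
  algebra valued function defined at bonds of Λ."*; p. 428 [PDF 40]: *"This form is considered on the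
  subspace {B: B = 0 on Λᶜ, B = 0 on ⋃_{y∈Λ′}Ax(y), Q₁B = 0}."*
* p. 429 [PDF 41], (3.161): *"× ∫dA∫dμ↾_Λ δ(Q′₁μ)∫dλ δ(Q′λ − μ)δ(QA + D̄Q′λ − B) …"* and *"where we have applied the
  identity (3.115), and for b∈Λ_j (D̄Q′λ)(b) = (D̄^jQ′_jλ)(b)."*
* p. 430 [PDF 42] — THE PASSAGE TYPED HERE: *"In this integral we change the order of B- and μ-integrations, and we
  perform the gauge transformation B → B + D̄μ. This gives us the following μ-integral to calculate
  ∫dμ δ(Q′₁μ)δ_{Ax}(B + D̄μ)G(μ). (3.168) The δ-functions above determine μ uniquely as a linear function of B. Indeed,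
  denoting V = Ū^k, we have for x∈B(y), y∈Λ′
  (R_y(V)(B + D̄μ))(Γ_{y,x}) = (R_y(V)B)(Γ_{y,x}) + R(V(Γ_{y,x}))μ(x) − μ(y) = 0, hence
  R(V(Γ_{y,x}))μ(x) = μ(y) − (R_y(V)B)(Γ_{y,x}), and
  (Q′μ)(y) = Σ_{x∈B(y)} L^{−d}R(V(Γ_{y,x}))μ(x) = μ(y) − Σ_{x∈B(y)} L^{−d}(R_y(V)B)(Γ_{y,x}) = μ(y) − Q′(R_y(V)B)(Γ_{y,·}) = 0.
  This implies μ(y) = Q′(R_y(V)B)(Γ_{y,·}), μ(x) = R(V(Γ_{x,y}))Q′(R_y(V)B)(Γ_{y,·}) − R(V(Γ_{x,y}))(R_y(V)B)(Γ_{y,x}),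
  x∈B(y), x ≠ y. (3.169) We denote the linear function defined by the above formulas by μ(B). The integral (3.168) is
  equal to G(μ(B))."*; and (3.170) uses *"QA + D̄μ(QA)"*.
* p. 432 [PDF 44], (3.185): *"C^{(k)}(Λ) = (I + D̄μ)QG̃₂Q*(I + μ*D̄*). (3.185) … The formula (3.185) implies immediately
  bounds and an exponential decay."*

THE READING (typed objects; every choice is recorded in the cell's DIVERGENCE D-b09.40 — a typing, not a claim about the
print; the cell's hand certifications of this passage are GAPS C-adv8-2, C-adv4-55, with the print slips G-adv8-2
(δ(Q′μ) in (3.167) vs δ(Q′₁μ) in (3.168)) and G-adv4-33, and the boundary-bond convention G-adv8-1).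
(a) CARRIERS.  `X` = the finite set of sites at which μ is evaluated; `Bond` = the bond set on which B and g live,
    with endpoint maps `src b = b₋`, `tgt b = b₊` into X; `𝔤` = a real vector space (the Lie algebra); the background
    V = Ū^k enters ONLY through its bond transports `R b : 𝔤 ≃ₗ[ℝ] 𝔤` (= R(V(b)), the adjoint action, p. 390).
    Blocks: `blk : X → X` sends a site x ∈ B(y) to the base site y ∈ Λ′ of its block (idempotent); `Γ x` = the contour
    Γ_{y,x} as a LIST OF BONDS read from y (a chain: consecutive, `src` of the first = y, `tgt` of the last = x;
    `Γ y = []`); `w x` = the averaging weight of x in its block (print: L^{−d}, #B(y) = L^d; typed: nonnegative, summing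
    to 1 over each block).  All this is ONE structure `AxialFrame`.  BOUNDARY CONVENTION (G-adv8-1 — the print never
    says which bonds *"B↾_Λ"* means; the cell's repair is the star convention bonds(Λ) = ⋃_{x∈Λ}st(x), under which
    B → B + D̄μ IS a change of variables and (D̄μ)(b) = −μ(b₋) at a bond leaving Λ): the module does not choose — X is
    the sites of Λ (blocks B(y), y ∈ Λ′) together with, under the star convention, the outer endpoints b₊ ∉ Λ of the
    boundary bonds typed as SINGLETON BLOCKS with empty contour, where μ(B) = 0 automatically
    (`mu_eq_zero_of_trivial_block`) and the averaging constraint reads μ(b₊) = 0 (Dirichlet for μ); with bonds having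
    both endpoints in Λ, X = the sites of Λ.  Either way every theorem below applies verbatim.
(b) OPERATIONS.  `hol R Γ` = R(V(Γ)) (composite transport along the chain, R(V(b₁))∘⋯∘R(V(b_n)));
    `trSum R B Γ` = (R_y(V)B)(Γ) = Σ_i R(V(b₁⋯b_{i−1}))B(b_i) (the values of B along Γ transported back to its initial
    point — the standard reading of Bałaban's R_y(V)B evaluated on a contour ([5] (58) p. 27 is its multiplicative
    form), under which the printed identity (R_y(V)(B + D̄μ))(Γ_{y,x}) = (R_y(V)B)(Γ_{y,x}) + R(V(Γ_{y,x}))μ(x) − μ(y)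
    is additivity plus the TELESCOPING proved here); `cod R src tgt μ` = D̄μ, (D̄μ)(b) = R(V(b))μ(b₊) − μ(b₋) (p. 390 with η = 1, V for U₀);
    `bavg` = Q′(R_y(V)B)(Γ_{y,·}) = Σ_{x∈B(y)} w(x)·(R_y(V)B)(Γ_{y,x}) (G-adv4-33: the PLAIN weighted block mean of the
    transported sums — the transports are already inside R_y(V)B); the two δ-functions of (3.168) are typed as
    `AxialConstraint` ((R_y(V)(B + D̄μ))(Γ_{y,x}) = 0 for every x — the form the print USES; its equivalence with
    *"B + D̄μ = 0 on ⋃Ax(y)"* bondwise is proved under the tree property of the contours, `IsTree`: every axial bond is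
    the last bond of a contour whose prefix is again a contour, true for the straight-line combs of [5] p. 24) and
    `AvgConstraint` ((Q′μ)(y) = Σ_{x∈B(y)} w(x)R(V(Γ_{y,x}))μ(x) = 0, the one-step line of (3.18)–(3.19) with the
    block weights; G-adv8-2: this is
    the δ(Q′₁μ) of (3.168), one averaging step on Λ).
(c) THE SCALAR MODEL for the matrix clauses (cell readings D-b09.17 (i) — scalar transports — and D-b09.39 (a)–(c) —
    (3.185) as a matrix identity over an index set P with a site map, locality as two numbers r, m): 𝔤 = ℝ and
    R(V(b)) = multiplication by u(b) with |u(b)| = 1 (for an abelian group the adjoint action is trivial, u ≡ 1); then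
    E = I + D̄μ(·) IS a real matrix `Emat` on `Bond`, and (3.185)'s factors are matrices as in `Rep3185`.  For dim 𝔤 = N
    with orthogonal R(V(b)) the same algebra gives E as a Bond × Bond family of operator blocks with the same range and
    the same OPERATOR-NORM row sums; scalar-entry row sums then carry a dimension factor (≤ √N) — recorded, not typed.
(d) CONSTANTS.  Range: E(b,b′) ≠ 0 ⇒ b′ = b or b′ is an axial bond of the block of b₋ or of b₊; with a pseudo-distance ρ
    on sites, blocks of ρ-diameter ≤ D, bonds of ρ-length ≤ 1 and axial bonds sourced in their block this gives
    ρ(b₋, b′₋) ≤ D + 1 =: r.  Row sums: Σ_{b′}|E(b,b′)| ≤ 1 + 4ℓ =: m, ℓ = the maximal contour length (each μ(x)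
    has coefficient ℓ¹-mass ≤ 2ℓ: one block mean of transported sums plus one transported sum, all transports of
    modulus one).  Print instances (NOT typed): L-blocks of the unit lattice, combs of length ≤ d(L − 1), D = diam B(y),
    so r and m *"depend on d and L only"* as Theorem 3.15 requires.

WHAT THIS MODULE PROVES (kernel-checked; no `sorry`, no axiom beyond Lean's three):
1. §1 chains: `trSum_cod` — THE TELESCOPING (R_y(V)D̄μ)(Γ_{y,x}) = R(V(Γ_{y,x}))μ(x) − μ(y) for every chain Γ_{y,x} from y
   to x; additivity/homogeneity/support of transported sums (`trSum_add`, `trSum_smul`, `trSum_congr`,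
   `trSum_eq_zero`, `trSum_append`).
2. §2 (3.169) on an `AxialFrame`: `mu` = the printed μ(B) (μ(y) = block mean of transported sums at base sites,
   μ(x) = R(V(Γ_{y,x}))⁻¹(μ(y) − (R_y(V)B)(Γ_{y,x})) — R(V(Γ_{x,y})) = R(V(Γ_{y,x}))⁻¹); EXISTENCE `axial_mu`, `avg_mu`
   (μ(B) satisfies both constraints) and, under `IsTree`, `dress_vanish` (B + D̄μ(B) vanishes on every axial bond —
   δ_{Ax}(B + D̄μ) literally); UNIQUENESS `mu_unique` (any μ satisfying both constraints equals μ(B)) and `mu_unique'`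
   (the bondwise form); LINEARITY `mu_add`, `mu_smul`, `muLin`, and of the dressing E(B) = B + D̄μ(B): `dress_add`,
   `dress_smul`, `dressLin`; LOCALITY `bavg_congr`, `mu_congr` (μ(B)(x) depends on B on the axial bonds of the block of
   x only), `dress_congr` (E(B)(b) depends on B(b) and on B on the axial bonds of the blocks of b₋, b₊ only);
   `mu_eq_zero_of_trivial_block` (μ(B) = 0 on singleton blocks — the boundary convention of reading (a)).
3. §3 scalar model: `trSum_Rs`, `mu_Rs`, `dress_Rs` (explicit coefficient kernels `scoef`, `Kmat`, `Emat`: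
   E(B) = Emat·B); `Emat_ne_zero` (combinatorial range), `Emat_range` (metric range ≤ D + 1 under the hypotheses of
   reading (d)), `sum_abs_scoef_le` (≤ contour length), `sum_abs_Kmat_le` (≤ 2ℓ), `sum_abs_Emat_le` (≤ 1 + 4ℓ).
4. §4 THE EDGE `rep3185_of_eq3169`: the (3.185) data `B9Thm315Decay.Rep3185 … U δ₁ B₁ (D + 1) (1 + 4ℓ)` from an axial
   frame in the scalar model, a site chart σ into r1's `B9.Geometry` with |σx − σx′| a pseudo-distance, the geometric
   hypotheses of reading (d), the factorisation C^{(k)}(Λ)(σb₋, σb′₋) = (Emat·S·Ematᵀ)(b,b′) and the random-walk bound on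
   S (these last two stay HYPOTHESES, exactly as in gen 11); `bound_3187_of_eq3169`: hence (3.187) at U with δ₀ = δ₁ and
   B₀ = B₁e^{2δ₁(D+1)}(1 + 4ℓ)².

WHAT IT DOES NOT PROVE (named hypotheses of printed shape, or not modelled): the δ-function bookkeeping (3.159)–(3.182)
around (3.168)–(3.170) (the change of variables B → B + D̄μ and its bond convention G-adv8-1, the Jacobian, *"The
integral (3.168) is equal to G(μ(B))"* — certified by hand in C-adv4-55, C-adv8-2, not typed); the identification of
the print's contours (*"(52), (53) in [5]"*; [5] p. 24, B5 (1.7)) with an `AxialFrame`/`IsTree` instance and the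
values D = diam B(y),
ℓ ≤ d(L − 1) (reading (d)); the non-abelian matrix clauses (reading (c): operator blocks, the √N); the factorisation
(3.185) and the random-walk bound of QG̃₂Q* (G-B9-10, C-adv8-2 — OPEN, as in gen 11); anything about Q₁, H₁, D̃^{(2)},
G.  Value = kernel certificate of a printed explicit linear-algebra step and of the locality constants it yields for
Theorem 3.15's last step — typed skeleton / located gap, NOT summit progress.

v1.1 (DOCFIX, docstring-only; XREAD adv1-g42 **ok**, GAPS C-A48-1): (R1) the p. 390 quotation restored to the print's
symbol A (v1 wrote λ inside the quotation marks); (R2) the p. 393 one-step display relabelled as the unnumbered line of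
the (3.18)–(3.19) group; (R4) the `IsTree` docstring aligned with its statement; [5]'s equation numbers annotated
(preprint vs CMP 98) with the published p. 24 display and (58) p. 27 quoted.  No declaration changed (R3 — incoming
boundary bonds under the star convention — is records-only: an instance should take `Bond` = bonds with b₋ ∈ Λ).

CHART NOTE (v1.2; see `B9Eq3169MuN` §B, b09 gen 12, GAPS C-B9-60).  `rep3185_of_eq3169` / `bound_3187_of_eq3169`
chart the (3.185) index set into the sites THROUGH THE INITIAL POINTS, e = σ ∘ `A.src`; the hypothesis `hfac` :
C^{(k)}(Λ; σ p₋, σ q₋) = (E S Eᵀ)(p, q) therefore identifies the entries of the bond-indexed E S Eᵀ over all bond pairs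
with common initial points (`B9Eq3169MuN.srcChart_forces_eq`) — harmless when `A.src` is injective (d = 1),
OVER-STRONG otherwise (d ≥ 2: d bonds leave each site, while the print's C^{(k)}(Λ) is bond-indexed, (3.155) *"defined
at bonds of Λ"*).  The theorems are valid as stated (a special, non-injective chart); for instantiation use the
BOND-CHART edges `B9Eq3169MuN.rep3185_of_eq3169_chart` / `rep3185Dom_of_eq3169_chart` (any χ : Bond → Site with
unitDist(χ b, χ b′) = ρ(b₋, b′₋): ONE equation per bond pair as printed, `inΛ` := the image of χ, no coverage
hypothesis) or the vector-model edge `rep3185Dom_of_eq3169N`; §§1–3 and the constants r = D + 1, m = 1 + 4ℓ are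
unaffected.

v1.2 (DOCFIX, docstring-only; XREAD pv24-g9 of `B9Eq3169Comb` **ok**, GAPS C-pv24g9-9, R1 applies here verbatim):
[5]'s (52)/(53) p. 26 described correctly ((52) the small-field condition, (53) the inductive plaquette bound — v1.1
called both "small-field conditions"); the CHART NOTE above added (owed since `B9Eq3169MuN`).  No declaration,
statement or proof changed. -/

namespace Literature.MathematicalPhysics.QuantumFieldTheory.Balaban1983to89.B9Eq3169Mu

open Finset
open scoped Matrix
open B4Sect5Torus (IsPseudoDist)

/-! ## §1  Bond chains, transports, transported sums, the covariant difference D̄, telescoping -/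

section Chains

variable {X Bond 𝔤 : Type} [AddCommGroup 𝔤] [Module ℝ 𝔤]

/-- `IsChainFrom src tgt y Γ x`: the bond list Γ = [b₁, …, b_n] is a chain from the site y to the site x
(b₁₋ = y, b_{i+1,−} = b_{i,+}, b_{n,+} = x; the empty chain joins y to itself) — the contours Γ_{y,x} of (3.169) read
from their initial point y. [cite: Balaban1985BackgroundPropagators, p.393 (3.18)–(3.19) + p.430 (3.169)] -/
def IsChainFrom (src tgt : Bond → X) : X → List Bond → X → Prop
  | y, [], x => y = x
  | y, b :: Γ, x => src b = y ∧ IsChainFrom src tgt (tgt b) Γ x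

/-- The empty chain joins y to x iff y = x. [folklore] -/
@[simp] theorem isChainFrom_nil (src tgt : Bond → X) (y x : X) : IsChainFrom src tgt y [] x ↔ y = x := Iff.rfl

/-- A nonempty chain from y starts with a bond sourced at y and continues from its target. [folklore] -/
@[simp] theorem isChainFrom_cons (src tgt : Bond → X) (y x : X) (b : Bond) (Γ : List Bond) :
    IsChainFrom src tgt y (b :: Γ) x ↔ src b = y ∧ IsChainFrom src tgt (tgt b) Γ x := Iff.rfl

/-- R(V(Γ)) — the composite transport along a chain: R(V(b₁))∘⋯∘R(V(b_n)) (so that a value at the END point is carried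
back to the INITIAL point), from bond transports `R b` = R(V(b)), R(U)X = UXU⁻¹ (p. 390).
[cite: Balaban1985BackgroundPropagators, p.390 + p.393 (3.18)–(3.19)] -/
def hol (R : Bond → 𝔤 ≃ₗ[ℝ] 𝔤) : List Bond → (𝔤 ≃ₗ[ℝ] 𝔤)
  | [] => LinearEquiv.refl ℝ 𝔤
  | b :: Γ => (hol R Γ).trans (R b)

/-- R(V(∅)) = identity. [folklore] -/
@[simp] theorem hol_nil (R : Bond → 𝔤 ≃ₗ[ℝ] 𝔤) : hol R [] = LinearEquiv.refl ℝ 𝔤 := rfl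

/-- R(V(bΓ)) = R(V(b))R(V(Γ)). [folklore] -/
@[simp] theorem hol_cons_apply (R : Bond → 𝔤 ≃ₗ[ℝ] 𝔤) (b : Bond) (Γ : List Bond) (v : 𝔤) :
    hol R (b :: Γ) v = R b (hol R Γ v) := rfl

/-- (R_y(V)B)(Γ) — the TRANSPORTED SUM of a bond function B along a chain Γ from y: Σ_i R(V(b₁))⋯R(V(b_{i−1}))B(b_i)
(each value carried back to the initial point y). [cite: Balaban1985BackgroundPropagators, p.430 (3.169)] -/
def trSum (R : Bond → 𝔤 ≃ₗ[ℝ] 𝔤) (B : Bond → 𝔤) : List Bond → 𝔤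
  | [] => 0
  | b :: Γ => B b + R b (trSum R B Γ)

/-- The transported sum along the empty chain is 0. [folklore] -/
@[simp] theorem trSum_nil (R : Bond → 𝔤 ≃ₗ[ℝ] 𝔤) (B : Bond → 𝔤) : trSum R B [] = 0 := rfl

/-- (R_y(V)B)(bΓ) = B(b) + R(V(b))(R_{b₊}(V)B)(Γ). [folklore] -/
@[simp] theorem trSum_cons (R : Bond → 𝔤 ≃ₗ[ℝ] 𝔤) (B : Bond → 𝔤) (b : Bond) (Γ : List Bond) :
    trSum R B (b :: Γ) = B b + R b (trSum R B Γ) := rfl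

/-- D̄μ — the covariant difference of a site function: (D̄μ)(b) = R(V(b))μ(b₊) − μ(b₋) (p. 390, *"(D^η_{U₀}A)(b) =
η⁻¹(R(U₀(b))A(b₊) − A(b₋))"* for a site function the print calls A, here μ; unit lattice η = 1, V = Ū^k for U₀; the
D̄ of (3.115), (3.168)). [cite: Balaban1985BackgroundPropagators, p.390 + (3.115) p.418] -/
def cod (R : Bond → 𝔤 ≃ₗ[ℝ] 𝔤) (src tgt : Bond → X) (μ : X → 𝔤) : Bond → 𝔤 :=
  fun b => R b (μ (tgt b)) - μ (src b)

/-- (D̄μ)(b) = R(V(b))μ(b₊) − μ(b₋). [cite: Balaban1985BackgroundPropagators, p.390] -/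
@[simp] theorem cod_apply (R : Bond → 𝔤 ≃ₗ[ℝ] 𝔤) (src tgt : Bond → X) (μ : X → 𝔤) (b : Bond) :
    cod R src tgt μ b = R b (μ (tgt b)) - μ (src b) := rfl

/-- **TELESCOPING** (the printed *"(R_y(V)(B + D̄μ))(Γ_{y,x}) = (R_y(V)B)(Γ_{y,x}) + R(V(Γ_{y,x}))μ(x) − μ(y)"*, its
D̄μ part): along a chain Γ from y to x, (R_y(V)D̄μ)(Γ) = R(V(Γ))μ(x) − μ(y).
[cite: Balaban1985BackgroundPropagators, p.430 (3.169)] -/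
theorem trSum_cod (R : Bond → 𝔤 ≃ₗ[ℝ] 𝔤) (src tgt : Bond → X) (μ : X → 𝔤) :
    ∀ (y : X) (Γ : List Bond) (x : X), IsChainFrom src tgt y Γ x →
      trSum R (cod R src tgt μ) Γ = hol R Γ (μ x) - μ y
  | y, [], x, h => by
      have hyx : y = x := h
      subst hyx
      simp
  | y, b :: Γ, x, h => by
      obtain ⟨hb, hΓ⟩ := h
      rw [trSum_cons, trSum_cod R src tgt μ (tgt b) Γ x hΓ, hol_cons_apply, cod_apply, map_sub, ← hb]
      abel

/-- Transported sums read B only on the bonds of the chain. [folklore] -/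
theorem trSum_congr (R : Bond → 𝔤 ≃ₗ[ℝ] 𝔤) {B₁ B₂ : Bond → 𝔤} :
    ∀ Γ : List Bond, (∀ b ∈ Γ, B₁ b = B₂ b) → trSum R B₁ Γ = trSum R B₂ Γ
  | [], _ => rfl
  | b :: Γ, h => by
      rw [trSum_cons, trSum_cons, h b (by simp), trSum_congr R Γ fun b' hb' => h b' (by simp [hb'])]

/-- Additivity of transported sums in the bond function (the printed split of (R_y(V)(B + D̄μ))(Γ_{y,x})). [folklore] -/
theorem trSum_add (R : Bond → 𝔤 ≃ₗ[ℝ] 𝔤) (B₁ B₂ : Bond → 𝔤) :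
    ∀ Γ : List Bond, trSum R (B₁ + B₂) Γ = trSum R B₁ Γ + trSum R B₂ Γ
  | [] => by simp
  | b :: Γ => by
      rw [trSum_cons, trSum_cons, trSum_cons, trSum_add R B₁ B₂ Γ, Pi.add_apply, map_add]
      abel

/-- Homogeneity of transported sums. [folklore] -/
theorem trSum_smul (R : Bond → 𝔤 ≃ₗ[ℝ] 𝔤) (c : ℝ) (B : Bond → 𝔤) :
    ∀ Γ : List Bond, trSum R (c • B) Γ = c • trSum R B Γ
  | [] => by simp
  | b :: Γ => by rw [trSum_cons, trSum_cons, trSum_smul R c B Γ, Pi.smul_apply, map_smul, smul_add]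

/-- A bond function vanishing on the chain has transported sum zero (*"B = 0 on ⋃Ax(y)"* ⇒ the axial constraints).
[folklore] -/
theorem trSum_eq_zero (R : Bond → 𝔤 ≃ₗ[ℝ] 𝔤) {B : Bond → 𝔤} :
    ∀ Γ : List Bond, (∀ b ∈ Γ, B b = 0) → trSum R B Γ = 0
  | [], _ => rfl
  | b :: Γ, h => by
      rw [trSum_cons, h b (by simp), trSum_eq_zero R Γ fun b' hb' => h b' (by simp [hb']), map_zero, add_zero]

/-- Transported sum of a concatenation: the second piece is carried back by the transport of the first. [folklore] -/
theorem trSum_append (R : Bond → 𝔤 ≃ₗ[ℝ] 𝔤) (B : Bond → 𝔤) :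
    ∀ Γ₁ Γ₂ : List Bond, trSum R B (Γ₁ ++ Γ₂) = trSum R B Γ₁ + hol R Γ₁ (trSum R B Γ₂)
  | [], Γ₂ => by simp
  | b :: Γ₁, Γ₂ => by
      rw [List.cons_append, trSum_cons, trSum_cons, trSum_append R B Γ₁ Γ₂, hol_cons_apply, map_add]
      abel

/-- The transported sum along a one-bond chain is the value on that bond. [folklore] -/
@[simp] theorem trSum_singleton (R : Bond → 𝔤 ≃ₗ[ℝ] 𝔤) (B : Bond → 𝔤) (b : Bond) : trSum R B [b] = B b := by
  simp

/-- D̄ is additive. [folklore] -/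
theorem cod_add (R : Bond → 𝔤 ≃ₗ[ℝ] 𝔤) (src tgt : Bond → X) (μ₁ μ₂ : X → 𝔤) :
    cod R src tgt (μ₁ + μ₂) = cod R src tgt μ₁ + cod R src tgt μ₂ := by
  funext b
  simp only [cod_apply, Pi.add_apply, map_add]
  abel

/-- D̄ is homogeneous. [folklore] -/
theorem cod_smul (R : Bond → 𝔤 ≃ₗ[ℝ] 𝔤) (src tgt : Bond → X) (c : ℝ) (μ : X → 𝔤) :
    cod R src tgt (c • μ) = c • cod R src tgt μ := by
  funext b
  simp only [cod_apply, Pi.smul_apply, map_smul, smul_sub]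

end Chains

/-! ## §2  The axial frame of Sect. E and the linear function μ(B) of (3.169) -/

section Frame

variable {X Bond 𝔤 : Type} [Fintype X] [DecidableEq X] [AddCommGroup 𝔤] [Module ℝ 𝔤]

/-- THE AXIAL FRAME of Sect. E on the sites X of Λ (reading (a)): bonds with endpoints `src` = b₋, `tgt` = b₊; the block
map `blk` (x ∈ B(y) ↦ the base site y ∈ Λ′, idempotent); the contours `Γ x` = Γ_{y,x} ⊂ B(y) as bond chains from
y = blk x to x, empty at the base sites; the averaging weights `w` of Q′ on each block (print: L^{−d} on the L^d sites of
B(y); typed: nonnegative with block sums 1).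
[cite: Balaban1985BackgroundPropagators, p.393 (3.18)–(3.19) + p.430 (3.169)] -/
structure AxialFrame (X Bond : Type) [Fintype X] [DecidableEq X] where
  /-- b₋ -/
  src : Bond → X
  /-- b₊ -/
  tgt : Bond → X
  /-- x ∈ B(y) ↦ y -/
  blk : X → X
  /-- Γ_{y,x}, y = blk x, as a bond chain read from y -/
  Γ : X → List Bond
  /-- the weight of x in (Q′·)(y), print L^{−d} -/
  w : X → ℝ
  blk_blk : ∀ x, blk (blk x) = blk x
  chain : ∀ x, IsChainFrom src tgt (blk x) (Γ x) x
  Γ_blk : ∀ x, Γ (blk x) = []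
  w_nonneg : ∀ x, 0 ≤ w x
  w_sum : ∀ x, ∑ x' ∈ Finset.univ.filter (fun x' => blk x' = blk x), w x' = 1

namespace AxialFrame

variable (A : AxialFrame X Bond)

/-- The block B(y) ∋ x as a finite set of sites. [cite: Balaban1985BackgroundPropagators, p.393 (3.18)–(3.19)] -/
def block (x : X) : Finset X := Finset.univ.filter (fun x' => A.blk x' = A.blk x)

/-- x′ ∈ B(y) ∋ x iff x′ and x have the same base site. [folklore] -/
@[simp] theorem mem_block {x x' : X} : x' ∈ A.block x ↔ A.blk x' = A.blk x := by simp [block]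

/-- Sites with the same base site have the same block. [folklore] -/
theorem block_eq_of_blk_eq {x x' : X} (h : A.blk x' = A.blk x) : A.block x' = A.block x := by
  ext z
  simp [block, h]

/-- The block of the base site y is B(y). [folklore] -/
theorem block_blk (x : X) : A.block (A.blk x) = A.block x := A.block_eq_of_blk_eq (A.blk_blk x)

/-- Σ_{x′∈B(y)} w(x′) = 1 (print: L^d sites of weight L^{−d}).
[cite: Balaban1985BackgroundPropagators, p.393 (3.18)–(3.19)] -/
theorem sum_w (x : X) : ∑ x' ∈ A.block x, A.w x' = 1 := A.w_sum x

/-- `A.InAx x b`: b is an AXIAL BOND of the block of x — a bond of some contour Γ_{y,x′}, x′ ∈ B(y), y = blk x (the set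
Ax(y) of p. 428). [cite: Balaban1985BackgroundPropagators, p.428] -/
def InAx (x : X) (b : Bond) : Prop := ∃ x', A.blk x' = A.blk x ∧ b ∈ A.Γ x'

/-- THE TREE PROPERTY of the contours, AS TYPED: every bond b of a contour `Γ x` is the LAST bond of some contour
`Γ x₂` whose prefix is again a contour `Γ x₁` — with x₁, x₂ NOT tied to b₋, b₊ or to the block of x (weaker than the
geometric statement, sufficient for every use below).  For the straight-line combs of [5] p. 24 / B5 (1.7) it holds
with x₁ = b₋, x₂ = b₊ in the block of x.  Under it the transported-sum form of the axial constraints is equivalent to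
the bondwise vanishing *"B = 0 on ⋃Ax(y)"*.
[cite: Balaban1985BackgroundPropagators, p.393 + p.428; Balaban1985Averaging, p.24 (unnumbered display)] -/
def IsTree (F : AxialFrame X Bond) : Prop := ∀ x b, b ∈ F.Γ x → ∃ x₁ x₂, F.Γ x₂ = F.Γ x₁ ++ [b]

variable (R : Bond → 𝔤 ≃ₗ[ℝ] 𝔤)

/-- Q′(R_y(V)B)(Γ_{y,·}) at the block of x: the weighted block mean Σ_{x′∈B(y)} w(x′)(R_y(V)B)(Γ_{y,x′}) of the
transported sums (reading (b), G-adv4-33). [cite: Balaban1985BackgroundPropagators, p.430 (3.169)] -/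
def bavg (B : Bond → 𝔤) (x : X) : 𝔤 := ∑ x' ∈ A.block x, A.w x' • trSum R B (A.Γ x')

/-- **μ(B) of (3.169)**: μ(x) = R(V(Γ_{y,x}))⁻¹(Q′(R_y(V)B)(Γ_{y,·}) − (R_y(V)B)(Γ_{y,x})) for x ∈ B(y) — at the base
site x = y (Γ_{y,y} = ∅) this is μ(y) = Q′(R_y(V)B)(Γ_{y,·}), and R(V(Γ_{x,y})) = R(V(Γ_{y,x}))⁻¹.
[cite: Balaban1985BackgroundPropagators, (3.169) p.430] -/
def mu (B : Bond → 𝔤) (x : X) : 𝔤 := (hol R (A.Γ x)).symm (A.bavg R B x - trSum R B (A.Γ x))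

/-- E(B) = (I + D̄μ(·))B = B + D̄μ(B): the field after the gauge transformation B → B + D̄μ of p. 430 with μ = μ(B) — the
factor I + D̄μ of (3.185). [cite: Balaban1985BackgroundPropagators, p.430 + (3.185) p.432] -/
def dress (B : Bond → 𝔤) : Bond → 𝔤 := B + cod R A.src A.tgt (A.mu R B)

/-- The δ_{Ax}(B + D̄μ) constraint in the form the print uses: (R_y(V)(B + D̄μ))(Γ_{y,x}) = 0 for every x ∈ B(y),
y ∈ Λ′. [cite: Balaban1985BackgroundPropagators, p.430] -/
def AxialConstraint (B : Bond → 𝔤) (μ : X → 𝔤) : Prop :=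
  ∀ x, trSum R (B + cod R A.src A.tgt μ) (A.Γ x) = 0

/-- The δ(Q′₁μ) constraint: (Q′μ)(y) = Σ_{x∈B(y)} w(x)R(V(Γ_{y,x}))μ(x) = 0 for every block (the one-step line of
(3.18)–(3.19) with V = Ū^k). [cite: Balaban1985BackgroundPropagators, p.430 + (3.18)–(3.19) p.393] -/
def AvgConstraint (μ : X → 𝔤) : Prop := ∀ x, ∑ x' ∈ A.block x, A.w x' • hol R (A.Γ x') (μ x') = 0

/-- The block mean is a function of the block. [folklore] -/
theorem bavg_eq_of_blk_eq (B : Bond → 𝔤) {x x' : X} (h : A.blk x' = A.blk x) :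
    A.bavg R B x' = A.bavg R B x := by
  simp only [bavg, A.block_eq_of_blk_eq h]

/-- The block mean at the base site. [folklore] -/
theorem bavg_blk (B : Bond → 𝔤) (x : X) : A.bavg R B (A.blk x) = A.bavg R B x :=
  A.bavg_eq_of_blk_eq R B (A.blk_blk x)

/-- The printed intermediate *"R(V(Γ_{y,x}))μ(x) = μ(y) − (R_y(V)B)(Γ_{y,x})"* for μ = μ(B) (with μ(y) = Q′(…)).
[cite: Balaban1985BackgroundPropagators, p.430] -/
theorem hol_mu (B : Bond → 𝔤) (x : X) : hol R (A.Γ x) (A.mu R B x) = A.bavg R B x - trSum R B (A.Γ x) := by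
  simp [mu]

/-- μ(B) at a base site: *"μ(y) = Q′(R_y(V)B)(Γ_{y,·})"*. [cite: Balaban1985BackgroundPropagators, (3.169) p.430] -/
theorem mu_blk (B : Bond → 𝔤) (x : X) : A.mu R B (A.blk x) = A.bavg R B x := by
  simp only [mu, A.Γ_blk, hol_nil, trSum_nil, sub_zero, LinearEquiv.refl_symm, LinearEquiv.refl_apply, bavg_blk]

/-- A block all of whose contours are empty — a singleton block {z}, e.g. an outer endpoint z = b₊ ∉ Λ of a boundary bond
under the star convention bonds(Λ) = ⋃_{x∈Λ}st(x) of G-adv8-1's repair — carries μ(B) = 0 (the Dirichlet condition for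
μ; at such a bond (D̄μ)(b) = R(V(b))·0 − μ(b₋) = −μ(b₋)). [folklore] -/
theorem mu_eq_zero_of_trivial_block {x : X} (h : ∀ x' ∈ A.block x, A.Γ x' = []) (B : Bond → 𝔤) :
    A.mu R B x = 0 := by
  have hx : A.Γ x = [] := h x (by simp)
  have hb : A.bavg R B x = 0 := Finset.sum_eq_zero fun x' hx' => by rw [h x' hx', trSum_nil, smul_zero]
  simp only [mu, hx, hb, hol_nil, trSum_nil, sub_zero, LinearEquiv.refl_symm, LinearEquiv.refl_apply]

/-- **EXISTENCE, axial part**: μ(B) satisfies (R_y(V)(B + D̄μ))(Γ_{y,x}) = 0 for all x (additivity + telescoping + the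
definition). [cite: Balaban1985BackgroundPropagators, (3.169) p.430] -/
theorem axial_mu (B : Bond → 𝔤) : A.AxialConstraint R B (A.mu R B) := by
  intro x
  rw [trSum_add, trSum_cod R A.src A.tgt (A.mu R B) (A.blk x) (A.Γ x) x (A.chain x), hol_mu, mu_blk]
  abel

/-- **EXISTENCE, averaging part**: μ(B) satisfies (Q′μ)(y) = 0 for every block (Σ w = 1 on the block).
[cite: Balaban1985BackgroundPropagators, (3.169) p.430] -/
theorem avg_mu (B : Bond → 𝔤) : A.AvgConstraint R (A.mu R B) := by
  intro x
  have h : ∀ x' ∈ A.block x, A.w x' • hol R (A.Γ x') (A.mu R B x') =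
      A.w x' • A.bavg R B x - A.w x' • trSum R B (A.Γ x') := by
    intro x' hx'
    rw [hol_mu, A.bavg_eq_of_blk_eq R B (A.mem_block.1 hx'), smul_sub]
  rw [Finset.sum_congr rfl h, Finset.sum_sub_distrib, ← Finset.sum_smul, A.sum_w, one_smul]
  simp [bavg]

/-- **UNIQUENESS** — *"The δ-functions above determine μ uniquely as a linear function of B"*: a site function μ with
(R_y(V)(B + D̄μ))(Γ_{y,x}) = 0 for all x and (Q′μ)(y) = 0 for all y IS μ(B) (telescoping gives R(V(Γ_{y,x}))μ(x) =
μ(y) − (R_y(V)B)(Γ_{y,x}); averaging over the block gives μ(y) = Q′(R_y(V)B)(Γ_{y,·}); invert the transport).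
[cite: Balaban1985BackgroundPropagators, (3.169) p.430] -/
theorem mu_unique {B : Bond → 𝔤} {μ : X → 𝔤} (hax : A.AxialConstraint R B μ) (hav : A.AvgConstraint R μ) :
    μ = A.mu R B := by
  have h1 : ∀ x, hol R (A.Γ x) (μ x) = μ (A.blk x) - trSum R B (A.Γ x) := by
    intro x
    have h := hax x
    rw [trSum_add, trSum_cod R A.src A.tgt μ (A.blk x) (A.Γ x) x (A.chain x)] at h
    rw [← sub_eq_zero, ← h]
    abel
  have h2 : ∀ x, μ (A.blk x) = A.bavg R B x := by
    intro x
    have h := hav x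
    have h' : ∀ x' ∈ A.block x, A.w x' • hol R (A.Γ x') (μ x') =
        A.w x' • μ (A.blk x) - A.w x' • trSum R B (A.Γ x') := by
      intro x' hx'
      rw [h1 x', A.mem_block.1 hx', smul_sub]
    rw [Finset.sum_congr rfl h', Finset.sum_sub_distrib, ← Finset.sum_smul, A.sum_w, one_smul, sub_eq_zero] at h
    rw [h]
    rfl
  funext x
  calc μ x = (hol R (A.Γ x)).symm (hol R (A.Γ x) (μ x)) := ((hol R (A.Γ x)).symm_apply_apply (μ x)).symm
    _ = A.mu R B x := by rw [h1 x, h2 x]; rfl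

/-- Bondwise vanishing of B + D̄μ on the axial bonds (*"δ_{Ax}(B + D̄μ)"* read literally) implies the transported-sum
constraints. [cite: Balaban1985BackgroundPropagators, p.428 + p.430] -/
theorem axialConstraint_of_vanish {B : Bond → 𝔤} {μ : X → 𝔤}
    (h : ∀ x, ∀ b ∈ A.Γ x, (B + cod R A.src A.tgt μ) b = 0) : A.AxialConstraint R B μ :=
  fun x => trSum_eq_zero R (A.Γ x) (h x)

/-- Conversely, under the tree property the transported-sum constraints give bondwise vanishing on every axial bond
(peel the last bond: its value is carried back by an invertible transport). [folklore] -/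
theorem vanish_of_axialConstraint (hT : A.IsTree) {B : Bond → 𝔤} {μ : X → 𝔤} (h : A.AxialConstraint R B μ) :
    ∀ x, ∀ b ∈ A.Γ x, (B + cod R A.src A.tgt μ) b = 0 := by
  intro x b hb
  obtain ⟨x₁, x₂, h12⟩ := hT x b hb
  have e₂ := h x₂
  rw [h12, trSum_append, h x₁, zero_add, trSum_singleton, LinearEquiv.map_eq_zero_iff] at e₂
  exact e₂

/-- **UNIQUENESS, bondwise form**: B + D̄μ = 0 on ⋃_yAx(y) and Q′μ = 0 force μ = μ(B).
[cite: Balaban1985BackgroundPropagators, (3.168)–(3.169) p.430] -/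
theorem mu_unique' {B : Bond → 𝔤} {μ : X → 𝔤} (hv : ∀ x, ∀ b ∈ A.Γ x, (B + cod R A.src A.tgt μ) b = 0)
    (hav : A.AvgConstraint R μ) : μ = A.mu R B :=
  A.mu_unique R (A.axialConstraint_of_vanish R hv) hav

/-- **EXISTENCE, bondwise form** (under the tree property): E(B) = B + D̄μ(B) VANISHES on every axial bond — the gauge
B → B + D̄μ(B) puts B into the axial gauge of the blocks. [cite: Balaban1985BackgroundPropagators, (3.168) p.430] -/
theorem dress_vanish (hT : A.IsTree) (B : Bond → 𝔤) : ∀ x, ∀ b ∈ A.Γ x, A.dress R B b = 0 :=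
  A.vanish_of_axialConstraint R hT (A.axial_mu R B)

/-! ### Linearity — *"a linear function of B"* -/

/-- The block mean of transported sums is additive in B. [folklore] -/
theorem bavg_add (B₁ B₂ : Bond → 𝔤) (x : X) : A.bavg R (B₁ + B₂) x = A.bavg R B₁ x + A.bavg R B₂ x := by
  simp only [bavg, trSum_add, smul_add, Finset.sum_add_distrib]

/-- The block mean of transported sums is homogeneous in B. [folklore] -/
theorem bavg_smul (c : ℝ) (B : Bond → 𝔤) (x : X) : A.bavg R (c • B) x = c • A.bavg R B x := by
  rw [bavg, bavg, Finset.smul_sum]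
  refine Finset.sum_congr rfl fun x' _ => ?_
  rw [trSum_smul, smul_comm]

/-- μ(B₁ + B₂) = μ(B₁) + μ(B₂). [cite: Balaban1985BackgroundPropagators, (3.169) p.430] -/
theorem mu_add (B₁ B₂ : Bond → 𝔤) (x : X) : A.mu R (B₁ + B₂) x = A.mu R B₁ x + A.mu R B₂ x := by
  rw [mu, mu, mu, ← map_add, bavg_add, trSum_add]
  congr 1
  abel

/-- μ(cB) = cμ(B). [cite: Balaban1985BackgroundPropagators, (3.169) p.430] -/
theorem mu_smul (c : ℝ) (B : Bond → 𝔤) (x : X) : A.mu R (c • B) x = c • A.mu R B x := by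
  rw [mu, mu, bavg_smul, trSum_smul, ← smul_sub, map_smul]

/-- μ(·) as a linear map (Bond → 𝔤) →ₗ (X → 𝔤) — *"We denote the linear function defined by the above formulas by
μ(B)"*. [cite: Balaban1985BackgroundPropagators, (3.169) p.430] -/
def muLin : (Bond → 𝔤) →ₗ[ℝ] (X → 𝔤) where
  toFun := A.mu R
  map_add' B₁ B₂ := funext fun x => A.mu_add R B₁ B₂ x
  map_smul' c B := funext fun x => A.mu_smul R c B x

/-- `muLin` is μ(·). [folklore] -/
@[simp] theorem muLin_apply (B : Bond → 𝔤) : A.muLin R B = A.mu R B := rfl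

/-- E(B₁ + B₂) = E(B₁) + E(B₂). [cite: Balaban1985BackgroundPropagators, (3.185) p.432] -/
theorem dress_add (B₁ B₂ : Bond → 𝔤) : A.dress R (B₁ + B₂) = A.dress R B₁ + A.dress R B₂ := by
  funext b
  simp only [dress, Pi.add_apply, cod_apply, mu_add, map_add]
  abel

/-- E(cB) = cE(B). [cite: Balaban1985BackgroundPropagators, (3.185) p.432] -/
theorem dress_smul (c : ℝ) (B : Bond → 𝔤) : A.dress R (c • B) = c • A.dress R B := by
  funext b
  simp only [dress, Pi.add_apply, Pi.smul_apply, cod_apply, mu_smul, map_smul, smul_add, smul_sub]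

/-- E = I + D̄μ(·) as a linear map on bond functions — the first factor of (3.185).
[cite: Balaban1985BackgroundPropagators, (3.185) p.432] -/
def dressLin : (Bond → 𝔤) →ₗ[ℝ] (Bond → 𝔤) where
  toFun := A.dress R
  map_add' := A.dress_add R
  map_smul' := A.dress_smul R

/-- `dressLin` is E(·). [folklore] -/
@[simp] theorem dressLin_apply (B : Bond → 𝔤) : A.dressLin R B = A.dress R B := rfl

/-! ### Locality — μ(B)↾B(y) reads B on Ax(y) only; E(B)(b) reads B on {b} ∪ Ax(blk b₋) ∪ Ax(blk b₊) -/

/-- Q′(R_y(V)B)(Γ_{y,·}) depends on B restricted to the axial bonds of the block only. [folklore] -/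
theorem bavg_congr {B₁ B₂ : Bond → 𝔤} {x : X} (h : ∀ b, A.InAx x b → B₁ b = B₂ b) :
    A.bavg R B₁ x = A.bavg R B₂ x := by
  unfold bavg
  refine Finset.sum_congr rfl fun x' hx' => ?_
  rw [trSum_congr R (A.Γ x') fun b hb => h b ⟨x', A.mem_block.1 hx', hb⟩]

/-- **LOCALITY OF μ(B)**: μ(B)(x), x ∈ B(y), depends on B restricted to Ax(y) only (the printed formula (3.169) involves
(R_y(V)B)(Γ_{y,x′}) for x′ ∈ B(y) and nothing else). [cite: Balaban1985BackgroundPropagators, (3.169) p.430] -/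
theorem mu_congr {B₁ B₂ : Bond → 𝔤} {x : X} (h : ∀ b, A.InAx x b → B₁ b = B₂ b) :
    A.mu R B₁ x = A.mu R B₂ x := by
  rw [mu, mu, A.bavg_congr R h, trSum_congr R (A.Γ x) fun b hb => h b ⟨x, rfl, hb⟩]

/-- **LOCALITY OF E = I + D̄μ(·)**: E(B)(b) depends on B(b) and on B restricted to the axial bonds of the blocks of b₋
and b₊ only (D̄ has range one bond) — the finite range behind *"The formula (3.185) implies immediately bounds and an
exponential decay"*. [cite: Balaban1985BackgroundPropagators, (3.169) p.430 + (3.185) p.432] -/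
theorem dress_congr {B₁ B₂ : Bond → 𝔤} {b : Bond} (h0 : B₁ b = B₂ b)
    (hs : ∀ b', A.InAx (A.src b) b' → B₁ b' = B₂ b') (ht : ∀ b', A.InAx (A.tgt b) b' → B₁ b' = B₂ b') :
    A.dress R B₁ b = A.dress R B₂ b := by
  simp only [dress, Pi.add_apply, cod_apply, h0, A.mu_congr R hs, A.mu_congr R ht]

end AxialFrame

end Frame

/-! ## §3  The scalar model (𝔤 = ℝ, R(V(b)) = u(b)·, |u(b)| = 1): the matrix of E, its range and its row sums -/

section Scalar

variable {X Bond : Type}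

/-- Scalar bond transports: multiplication by u(b) ≠ 0 on 𝔤 = ℝ (reading (c); for an abelian gauge group the adjoint
action is trivial, u ≡ 1). [folklore] -/
noncomputable def Rs (u : Bond → ℝ) (hu : ∀ b, u b ≠ 0) (b : Bond) : ℝ ≃ₗ[ℝ] ℝ where
  toFun v := u b * v
  invFun v := (u b)⁻¹ * v
  map_add' v v' := mul_add _ _ _
  map_smul' c v := by
    simp only [smul_eq_mul, RingHom.id_apply]
    ring
  left_inv v := inv_mul_cancel_left₀ (hu b) v
  right_inv v := mul_inv_cancel_left₀ (hu b) v

/-- `Rs u hu b` is multiplication by u(b). [folklore] -/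
@[simp] theorem Rs_apply (u : Bond → ℝ) (hu : ∀ b, u b ≠ 0) (b : Bond) (v : ℝ) : Rs u hu b v = u b * v := rfl

/-- Products of nonzero transports are nonzero. [folklore] -/
theorem prod_map_ne_zero (u : Bond → ℝ) (hu : ∀ b, u b ≠ 0) : ∀ Γ : List Bond, (Γ.map u).prod ≠ 0
  | [] => by simp
  | b :: Γ => by
      rw [List.map_cons, List.prod_cons]
      exact mul_ne_zero (hu b) (prod_map_ne_zero u hu Γ)

/-- Products of transports of modulus one have modulus one. [folklore] -/
theorem abs_prod_map_eq_one (u : Bond → ℝ) (hu : ∀ b, |u b| = 1) : ∀ Γ : List Bond, |(Γ.map u).prod| = 1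
  | [] => by simp
  | b :: Γ => by rw [List.map_cons, List.prod_cons, abs_mul, hu b, abs_prod_map_eq_one u hu Γ, one_mul]

/-- In the scalar model R(V(Γ)) is multiplication by the product of the u(b), b ∈ Γ. [folklore] -/
theorem hol_Rs (u : Bond → ℝ) (hu : ∀ b, u b ≠ 0) :
    ∀ (Γ : List Bond) (v : ℝ), hol (Rs u hu) Γ v = (Γ.map u).prod * v
  | [], v => by simp
  | b :: Γ, v => by
      rw [hol_cons_apply, hol_Rs u hu Γ v, Rs_apply, List.map_cons, List.prod_cons, mul_assoc]

/-- In the scalar model R(V(Γ))⁻¹ is multiplication by the inverse product. [folklore] -/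
theorem hol_Rs_symm (u : Bond → ℝ) (hu : ∀ b, u b ≠ 0) (Γ : List Bond) (v : ℝ) :
    (hol (Rs u hu) Γ).symm v = ((Γ.map u).prod)⁻¹ * v := by
  rw [LinearEquiv.symm_apply_eq, hol_Rs, mul_inv_cancel_left₀ (prod_map_ne_zero u hu Γ)]

section Coef

variable [DecidableEq Bond]

/-- The coefficient of B(b′) in the transported sum along Γ: Σ over the occurrences of b′ in Γ of the product of the
u(b) over the preceding bonds. [folklore] -/
def scoef (u : Bond → ℝ) : List Bond → Bond → ℝ
  | [], _ => 0
  | b :: Γ, b' => (if b = b' then 1 else 0) + u b * scoef u Γ b'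

/-- scoef(Γ, b′) = 0 unless b′ ∈ Γ (support of transported sums). [folklore] -/
theorem scoef_eq_zero (u : Bond → ℝ) : ∀ (Γ : List Bond) (b' : Bond), b' ∉ Γ → scoef u Γ b' = 0
  | [], _, _ => rfl
  | b :: Γ, b', h => by
      rw [List.mem_cons, not_or] at h
      rw [scoef, if_neg (Ne.symm h.1), scoef_eq_zero u Γ b' h.2, mul_zero, add_zero]

variable [Fintype Bond]

/-- (R_y(V)B)(Γ) = Σ_{b′} scoef(Γ, b′)·B(b′) in the scalar model. [folklore] -/
theorem trSum_Rs (u : Bond → ℝ) (hu : ∀ b, u b ≠ 0) (B : Bond → ℝ) :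
    ∀ Γ : List Bond, trSum (Rs u hu) B Γ = ∑ b', scoef u Γ b' * B b'
  | [] => by simp [scoef]
  | b :: Γ => by
      have h1 : ∑ b', (if b = b' then (1 : ℝ) else 0) * B b' = B b := by
        rw [Finset.sum_eq_single b (fun b' _ hb' => by rw [if_neg (Ne.symm hb'), zero_mul])
          (fun h => absurd (Finset.mem_univ b) h)]
        simp
      rw [trSum_cons, Rs_apply, trSum_Rs u hu B Γ, Finset.mul_sum]
      simp only [scoef, add_mul, Finset.sum_add_distrib, h1, mul_assoc]

/-- Σ_{b′}|scoef(Γ, b′)| ≤ |Γ| when |u| ≤ 1. [folklore] -/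
theorem sum_abs_scoef_le (u : Bond → ℝ) (hu1 : ∀ b, |u b| ≤ 1) :
    ∀ Γ : List Bond, ∑ b', |scoef u Γ b'| ≤ Γ.length
  | [] => by simp [scoef]
  | b :: Γ => by
      have hind : ∑ b', |(if b = b' then (1 : ℝ) else 0)| = 1 := by
        rw [Finset.sum_eq_single b (fun b' _ hb' => by rw [if_neg (Ne.symm hb'), abs_zero])
          (fun h => absurd (Finset.mem_univ b) h)]
        simp
      have ih := sum_abs_scoef_le u hu1 Γ
      calc ∑ b', |scoef u (b :: Γ) b'|
          ≤ ∑ b', (|(if b = b' then (1 : ℝ) else 0)| + |u b| * |scoef u Γ b'|) :=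
            Finset.sum_le_sum fun b' _ => by
              rw [scoef, ← abs_mul]
              exact abs_add_le _ _
        _ = 1 + |u b| * ∑ b', |scoef u Γ b'| := by rw [Finset.sum_add_distrib, hind, Finset.mul_sum]
        _ ≤ 1 + 1 * (Γ.length : ℝ) :=
            add_le_add le_rfl (mul_le_mul (hu1 b) ih (Finset.sum_nonneg fun _ _ => abs_nonneg _) zero_le_one)
        _ = ((b :: Γ).length : ℝ) := by simp; ring

end Coef

section Kernel

variable [Fintype X] [DecidableEq X] [DecidableEq Bond] (A : AxialFrame X Bond) (u : Bond → ℝ)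

/-- THE KERNEL OF μ(·) in the scalar model: μ(B)(x) = Σ_{b′} Kmat(x, b′)B(b′),
Kmat(x, b′) = (Π_{Γ_{y,x}}u)⁻¹·(Σ_{x′∈B(y)} w(x′)scoef(Γ_{y,x′}, b′) − scoef(Γ_{y,x}, b′)).
[cite: Balaban1985BackgroundPropagators, (3.169) p.430] -/
noncomputable def Kmat (x : X) (b' : Bond) : ℝ :=
  (((A.Γ x).map u).prod)⁻¹ * ((∑ x' ∈ A.block x, A.w x' * scoef u (A.Γ x') b') - scoef u (A.Γ x) b')

/-- THE MATRIX OF E = I + D̄μ(·) in the scalar model: Emat(b, b′) = δ_{bb′} + u(b)Kmat(b₊, b′) − Kmat(b₋, b′).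
[cite: Balaban1985BackgroundPropagators, (3.169) p.430 + (3.185) p.432] -/
noncomputable def Emat : Matrix Bond Bond ℝ := fun b b' =>
  (if b = b' then 1 else 0) + u b * Kmat A u (A.tgt b) b' - Kmat A u (A.src b) b'

/-- Kmat(x, ·) is supported on the axial bonds of the block of x. [folklore] -/
theorem Kmat_eq_zero {x : X} {b' : Bond} (h : ¬ A.InAx x b') : Kmat A u x b' = 0 := by
  have h1 : ∀ x' ∈ A.block x, scoef u (A.Γ x') b' = 0 := fun x' hx' =>
    scoef_eq_zero u (A.Γ x') b' fun hb => h ⟨x', A.mem_block.1 hx', hb⟩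
  have h2 : scoef u (A.Γ x) b' = 0 := scoef_eq_zero u (A.Γ x) b' fun hb => h ⟨x, rfl, hb⟩
  rw [Kmat, h2, Finset.sum_eq_zero fun x' hx' => by rw [h1 x' hx', mul_zero]]
  simp

/-- **RANGE, combinatorial form**: Emat(b, b′) ≠ 0 ⇒ b′ = b, or b′ is an axial bond of the block of b₊, or of the
block of b₋. [cite: Balaban1985BackgroundPropagators, (3.169) p.430] -/
theorem Emat_ne_zero {b b' : Bond} (h : Emat A u b b' ≠ 0) :
    b' = b ∨ A.InAx (A.tgt b) b' ∨ A.InAx (A.src b) b' := by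
  by_contra hc
  simp only [not_or] at hc
  apply h
  rw [Emat, if_neg (fun e => hc.1 e.symm), Kmat_eq_zero A u hc.2.1, Kmat_eq_zero A u hc.2.2]
  simp

/-- **RANGE, metric form** (reading (d)): for a pseudo-distance ρ on sites with blocks of diameter ≤ D, bonds of
length ≤ 1 and axial bonds sourced inside their block, Emat(b, b′) ≠ 0 ⇒ ρ(b₋, b′₋) ≤ D + 1 — the range r of
`Rep3185`. [cite: Balaban1985BackgroundPropagators, (3.169) p.430 + (3.187) p.432] -/
theorem Emat_range (ρ : X → X → ℝ) (hρ : IsPseudoDist ρ) {D : ℝ}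
    (hdiam : ∀ x x', A.blk x' = A.blk x → ρ x x' ≤ D) (hbond : ∀ b, ρ (A.src b) (A.tgt b) ≤ 1)
    (hin : ∀ x b', b' ∈ A.Γ x → A.blk (A.src b') = A.blk x) :
    ∀ b b', Emat A u b b' ≠ 0 → ρ (A.src b) (A.src b') ≤ D + 1 := by
  intro b b' h
  have hD : 0 ≤ D := le_trans (le_of_eq (hρ.zero _).symm) (hdiam (A.src b) (A.src b) rfl)
  have hAx : ∀ x, A.InAx x b' → ρ x (A.src b') ≤ D := by
    rintro x ⟨x', hx', hb'⟩
    exact hdiam x (A.src b') (by rw [hin x' b' hb', hx'])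
  rcases Emat_ne_zero A u h with h1 | h2 | h3
  · rw [h1, hρ.zero]
    linarith
  · calc ρ (A.src b) (A.src b') ≤ ρ (A.src b) (A.tgt b) + ρ (A.tgt b) (A.src b') := hρ.triangle _ _ _
      _ ≤ 1 + D := add_le_add (hbond b) (hAx _ h2)
      _ = D + 1 := add_comm _ _
  · linarith [hAx _ h3]

variable [Fintype Bond]

/-- The block mean of transported sums as an explicit bilinear expression in the scalar model. [folklore] -/
theorem bavg_Rs (hu : ∀ b, u b ≠ 0) (B : Bond → ℝ) (x : X) :
    A.bavg (Rs u hu) B x = ∑ b', (∑ x' ∈ A.block x, A.w x' * scoef u (A.Γ x') b') * B b' := by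
  simp only [AxialFrame.bavg, trSum_Rs, smul_eq_mul, Finset.mul_sum, Finset.sum_mul]
  rw [Finset.sum_comm]
  simp only [mul_assoc]

/-- μ(B)(x) = Σ_{b′} Kmat(x, b′)B(b′). [cite: Balaban1985BackgroundPropagators, (3.169) p.430] -/
theorem mu_Rs (hu : ∀ b, u b ≠ 0) (B : Bond → ℝ) (x : X) :
    A.mu (Rs u hu) B x = ∑ b', Kmat A u x b' * B b' := by
  rw [AxialFrame.mu, hol_Rs_symm, bavg_Rs, trSum_Rs, ← Finset.sum_sub_distrib, Finset.mul_sum]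
  refine Finset.sum_congr rfl fun b' _ => ?_
  simp only [Kmat]
  ring

/-- E(B)(b) = Σ_{b′} Emat(b, b′)B(b′), i.e. E(B) = Emat·B. [cite: Balaban1985BackgroundPropagators, (3.185) p.432] -/
theorem dress_Rs (hu : ∀ b, u b ≠ 0) (B : Bond → ℝ) (b : Bond) :
    A.dress (Rs u hu) B b = ∑ b', Emat A u b b' * B b' := by
  have h1 : ∑ b', (if b = b' then (1 : ℝ) else 0) * B b' = B b := by
    rw [Finset.sum_eq_single b (fun b' _ hb' => by rw [if_neg (Ne.symm hb'), zero_mul])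
      (fun h => absurd (Finset.mem_univ b) h)]
    simp
  simp only [Emat, add_mul, sub_mul, Finset.sum_add_distrib, Finset.sum_sub_distrib, h1]
  rw [AxialFrame.dress, Pi.add_apply, cod_apply, Rs_apply, mu_Rs, mu_Rs, Finset.mul_sum]
  simp only [mul_assoc]
  abel

/-- E(B) = Emat·B as `Matrix.mulVec`. [cite: Balaban1985BackgroundPropagators, (3.185) p.432] -/
theorem dress_Rs_mulVec (hu : ∀ b, u b ≠ 0) (B : Bond → ℝ) : A.dress (Rs u hu) B = (Emat A u).mulVec B := by
  funext b
  rw [dress_Rs, Matrix.mulVec, dotProduct]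

/-- Row ℓ¹-mass of the kernel of μ(·): ≤ 2ℓ for contours of length ≤ ℓ and transports of modulus one. [folklore] -/
theorem sum_abs_Kmat_le (hu : ∀ b, |u b| = 1) {ℓ : ℝ} (hℓ : ∀ x, ((A.Γ x).length : ℝ) ≤ ℓ) (x : X) :
    ∑ b', |Kmat A u x b'| ≤ 2 * ℓ := by
  have hsc : ∀ x, ∑ b', |scoef u (A.Γ x) b'| ≤ ℓ := fun x =>
    (sum_abs_scoef_le u (fun b => (hu b).le) (A.Γ x)).trans (hℓ x)
  have hpt : ∀ b', |Kmat A u x b'| ≤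
      (∑ x' ∈ A.block x, A.w x' * |scoef u (A.Γ x') b'|) + |scoef u (A.Γ x) b'| := by
    intro b'
    rw [Kmat, abs_mul, abs_inv, abs_prod_map_eq_one u hu, inv_one, one_mul]
    refine (abs_sub _ _).trans (add_le_add ?_ le_rfl)
    refine (Finset.abs_sum_le_sum_abs _ _).trans (le_of_eq (Finset.sum_congr rfl fun x' _ => ?_))
    rw [abs_mul, abs_of_nonneg (A.w_nonneg x')]
  calc ∑ b', |Kmat A u x b'|
      ≤ ∑ b', ((∑ x' ∈ A.block x, A.w x' * |scoef u (A.Γ x') b'|) + |scoef u (A.Γ x) b'|) :=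
        Finset.sum_le_sum fun b' _ => hpt b'
    _ = (∑ x' ∈ A.block x, A.w x' * ∑ b', |scoef u (A.Γ x') b'|) + ∑ b', |scoef u (A.Γ x) b'| := by
        rw [Finset.sum_add_distrib, Finset.sum_comm]
        simp only [Finset.mul_sum]
    _ ≤ (∑ x' ∈ A.block x, A.w x' * ℓ) + ℓ :=
        add_le_add (Finset.sum_le_sum fun x' _ => mul_le_mul_of_nonneg_left (hsc x') (A.w_nonneg x')) (hsc x)
    _ = 2 * ℓ := by rw [← Finset.sum_mul, A.sum_w]; ring

/-- **ROW SUMS**: Σ_{b′}|Emat(b, b′)| ≤ 1 + 4ℓ — the m of `Rep3185`.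
[cite: Balaban1985BackgroundPropagators, (3.169) p.430 + (3.187) p.432] -/
theorem sum_abs_Emat_le (hu : ∀ b, |u b| = 1) {ℓ : ℝ} (hℓ : ∀ x, ((A.Γ x).length : ℝ) ≤ ℓ) (b : Bond) :
    ∑ b', |Emat A u b b'| ≤ 1 + 4 * ℓ := by
  have hind : ∑ b', |(if b = b' then (1 : ℝ) else 0)| = 1 := by
    rw [Finset.sum_eq_single b (fun b' _ hb' => by rw [if_neg (Ne.symm hb'), abs_zero])
      (fun h => absurd (Finset.mem_univ b) h)]
    simp
  calc ∑ b', |Emat A u b b'|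
      ≤ ∑ b', (|(if b = b' then (1 : ℝ) else 0)| + |u b * Kmat A u (A.tgt b) b'| + |Kmat A u (A.src b) b'|) :=
        Finset.sum_le_sum fun b' _ => (abs_sub _ _).trans (add_le_add (abs_add_le _ _) le_rfl)
    _ = 1 + ∑ b', |Kmat A u (A.tgt b) b'| + ∑ b', |Kmat A u (A.src b) b'| := by
        rw [Finset.sum_add_distrib, Finset.sum_add_distrib, hind]
        simp_rw [abs_mul, hu b, one_mul]
    _ ≤ 1 + 2 * ℓ + 2 * ℓ :=
        add_le_add (add_le_add le_rfl (sum_abs_Kmat_le A u hu hℓ _)) (sum_abs_Kmat_le A u hu hℓ _)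
    _ = 1 + 4 * ℓ := by ring

end Kernel

end Scalar

/-! ## §4  The edge: (3.169) supplies the locality clauses of `B9Thm315Decay.Rep3185` -/

section Edge

variable {X Bond : Type} [Fintype X] [DecidableEq X] [Fintype Bond] [DecidableEq Bond]

/-- **THE EDGE INTO (3.185)'s DATA**: an axial frame on the sites of Λ in the scalar model (|u| = 1, contours of
length ≤ ℓ), a site chart σ into r1's `B9.Geometry` along which |y − y′| is a pseudo-distance with blocks of diameter
≤ D, bonds of length ≤ 1 and axial bonds sourced in their block, every site of Λ a bond source, TOGETHER WITH the two
inputs that stay hypotheses exactly as in gen 11 — the factorisation C^{(k)}(Λ)(σb₋, σb′₋) = (E·S·Eᵀ)(b, b′) of (3.185)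
with E = THE MATRIX `Emat` OF I + D̄μ(·) and the random-walk bound |S(b,b′)| ≤ B₁e^{−δ₁|σb₋ − σb′₋|} of S = QG̃₂Q* — give
`Rep3185 … U δ₁ B₁ r m` with r = D + 1 and m = 1 + 4ℓ NOW THEOREMS (`Emat_range`, `sum_abs_Emat_le`).  CHART NOTE
(v1.2): the chart is e = σ ∘ `A.src`, so `hfac` identifies (E S Eᵀ)(p, q) over bond pairs with common initial points
(over-strong unless `A.src` is injective, `B9Eq3169MuN.srcChart_forces_eq`); the bond-chart form is
`B9Eq3169MuN.rep3185_of_eq3169_chart`.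
[cite: Balaban1985BackgroundPropagators, (3.169) p.430 + (3.185)–(3.187) p.432] -/
theorem rep3185_of_eq3169 {g : B9.Geometry} {Bg : B9.Backgrounds} {Ck : B9.SiteKernel g Bg} {inΛ : g.Site → Prop}
    {unitDist : g.Site → g.Site → ℝ} {U : Bg.Cfg} {δ₁ B₁ D ℓ : ℝ}
    (A : AxialFrame X Bond) (u : Bond → ℝ) (hu : ∀ b, |u b| = 1) (hℓ : ∀ x, ((A.Γ x).length : ℝ) ≤ ℓ)
    (σ : X → g.Site) (hρ : IsPseudoDist fun x x' => unitDist (σ x) (σ x'))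
    (hdiam : ∀ x x', A.blk x' = A.blk x → unitDist (σ x) (σ x') ≤ D)
    (hbond : ∀ b, unitDist (σ (A.src b)) (σ (A.tgt b)) ≤ 1)
    (hin : ∀ x b', b' ∈ A.Γ x → A.blk (A.src b') = A.blk x)
    (hcov : ∀ y, inΛ y → ∃ b : Bond, σ (A.src b) = y)
    (S : Matrix Bond Bond ℝ)
    (hfac : ∀ p q, Ck.ker U (σ (A.src p)) (σ (A.src q)) = (Emat A u * S * (Emat A u)ᵀ) p q)
    (hS : ∀ p q, |S p q| ≤ B₁ * Real.exp (-(δ₁ * unitDist (σ (A.src p)) (σ (A.src q))))) :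
    B9Thm315Decay.Rep3185 g Bg Ck inΛ unitDist U δ₁ B₁ (D + 1) (1 + 4 * ℓ) :=
  ⟨Bond, inferInstance, fun b => σ (A.src b), Emat A u, S, hcov, hρ.comp (fun b => A.src b), hfac, hS,
    Emat_range A u (fun x x' => unitDist (σ x) (σ x')) hρ hdiam hbond hin,
    sum_abs_Emat_le A u hu hℓ⟩

/-- Hence (3.187) at the configuration U with δ₀ = δ₁ and B₀ = B₁e^{2δ₁(D+1)}(1 + 4ℓ)² (`B9Thm315Decay.bound_of_rep3185`).
[cite: Balaban1985BackgroundPropagators, (3.187) p.432] -/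
theorem bound_3187_of_eq3169 {g : B9.Geometry} {Bg : B9.Backgrounds} {Ck : B9.SiteKernel g Bg}
    {inΛ : g.Site → Prop} {unitDist : g.Site → g.Site → ℝ} {U : Bg.Cfg} {δ₁ B₁ D ℓ : ℝ}
    (hB₁ : 0 ≤ B₁) (hδ₁ : 0 ≤ δ₁)
    (A : AxialFrame X Bond) (u : Bond → ℝ) (hu : ∀ b, |u b| = 1) (hℓ : ∀ x, ((A.Γ x).length : ℝ) ≤ ℓ)
    (σ : X → g.Site) (hρ : IsPseudoDist fun x x' => unitDist (σ x) (σ x'))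
    (hdiam : ∀ x x', A.blk x' = A.blk x → unitDist (σ x) (σ x') ≤ D)
    (hbond : ∀ b, unitDist (σ (A.src b)) (σ (A.tgt b)) ≤ 1)
    (hin : ∀ x b', b' ∈ A.Γ x → A.blk (A.src b') = A.blk x)
    (hcov : ∀ y, inΛ y → ∃ b : Bond, σ (A.src b) = y)
    (S : Matrix Bond Bond ℝ)
    (hfac : ∀ p q, Ck.ker U (σ (A.src p)) (σ (A.src q)) = (Emat A u * S * (Emat A u)ᵀ) p q)
    (hS : ∀ p q, |S p q| ≤ B₁ * Real.exp (-(δ₁ * unitDist (σ (A.src p)) (σ (A.src q))))) :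
    ∀ y y', inΛ y → inΛ y' →
      |Ck.ker U y y'| ≤ B₁ * Real.exp (2 * δ₁ * (D + 1)) * (1 + 4 * ℓ) * (1 + 4 * ℓ) *
        Real.exp (-(δ₁ * unitDist y y')) :=
  B9Thm315Decay.bound_of_rep3185 hB₁ hδ₁
    (rep3185_of_eq3169 A u hu hℓ σ hρ hdiam hbond hin hcov S hfac hS)

end Edge

end Literature.MathematicalPhysics.QuantumFieldTheory.Balaban1983to89.B9Eq3169Mu
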